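import Literature.NumberTheory.GaloisRepresentations.CubicEisensteinRamificationProofs
import HarnessLib

/-!
# A root of an Eisenstein polynomial of degree `n`: `n · v_𝔓(θ) = e(𝔓 ∣ 𝔭)`

`Proofs` file (theorems only, no definitions, no named facts) in topic
`NumberTheory/GaloisRepresentations`, landed by the seat of bsd.S15
(`Literature.NumberTheory.EllipticCurves.conductorNorm_eq_artinConductorNat_of_isElliptic`): the
degree-`n` form of the tree's `three_mul_ord_root_eq` / `two_mul_ord_root_eq` (Serre, *Local
Fields*, Ch. I §6, Prop. 17–18: Eisenstein equations and totally ramified extensions), for reading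
the ramification of an explicit field `K₀(θ)` off an Eisenstein equation of `θ`.

* `root_mem_of_forall_coeff_mem` — `θ ∈ 𝔓` if `θⁿ + Σ_{k<n} c_k θ^k = 0` with all `c_k ∈ 𝔭 = 𝔓 ∩ R`;
* `natDegree_mul_ord_root_eq` — **`n · v_𝔓(θ) = e(𝔓 ∣ 𝔭)`** if moreover `v_𝔭(c₀) = 1`;
* `ord_root_eq_one_of_ramificationIdx_le` — hence **`v_𝔓(θ) = 1` and `e = n`** as soon as
  `e ≤ n` (e.g. `n = [L : K]`): `θ` is a uniformizer of the totally ramified `𝔓`, and the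
  valuation normal form `ord_sum_mul_pow_eq_inf` (`OrdPowerBasisProofs`) applies with `ϖ = θ`.

## References

* J.-P. Serre, *Local Fields*, GTM 67 (1979), Ch. I §6 Prop. 17, 18. [SerreLocalFields1979]

## Design

Theorems only; setting of `CubicEisensteinRamificationProofs` (`R` Dedekind with fraction field `K`,
`L/K` finite separable, `𝔓` a maximal ideal of `integralClosure R L`); coefficients as a function
`c : ℕ → R` and the equation written with `Finset.range n`.  Axioms: `propext`, `Classical.choice`,
`Quot.sound`.
-/

noncomputable section

open scoped Classical

namespace Literature.NumberTheory.GaloisRepresentations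

variable (R : Type*) {K L : Type*} [CommRing R] [IsDedekindDomain R] [Field K] [Field L]
  [Algebra R K] [IsFractionRing R K] [Algebra R L] [Algebra K L] [IsScalarTower R K L]
  [FiniteDimensional K L] [Algebra.IsSeparable K L]
  (𝔓 : Ideal (integralClosure R L)) [𝔓.IsMaximal]

omit [IsDedekindDomain R] in
/-- If `θⁿ + Σ_{k<n} c_k θ^k = 0` with all `c_k ∈ 𝔭 = 𝔓 ∩ R` and `n ≥ 1`, then `θ ∈ 𝔓`
(`θⁿ ∈ 𝔭S ⊆ 𝔓`, `𝔓` prime). [folklore] -/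
theorem root_mem_of_forall_coeff_mem {θ : integralClosure R L} {n : ℕ} {c : ℕ → R}
    (hθ : θ ^ n + ∑ k ∈ Finset.range n, algebraMap R _ (c k) * θ ^ k = 0)
    (hc : ∀ k < n, c k ∈ 𝔓.under R) : θ ∈ 𝔓 := by
  have hsum : ∑ k ∈ Finset.range n, algebraMap R (integralClosure R L) (c k) * θ ^ k ∈ 𝔓 := by
    refine Ideal.sum_mem _ fun k hk ↦ Ideal.mul_mem_right _ _ ?_
    exact Ideal.mem_comap.mp (hc k (Finset.mem_range.mp hk))
  have hpow : θ ^ n ∈ 𝔓 := by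
    have e : θ ^ n = -(∑ k ∈ Finset.range n, algebraMap R (integralClosure R L) (c k) * θ ^ k) := by
      linear_combination hθ
    rw [e]; exact (Ideal.neg_mem_iff _).mpr hsum
  exact Ideal.IsPrime.mem_of_pow_mem inferInstance n hpow

include K in
/-- **A root of an Eisenstein polynomial of degree `n` has `n · v_𝔓(θ) = e(𝔓 ∣ 𝔭)`**: if
`θⁿ + Σ_{k<n} c_k θ^k = 0` with `c_k ∈ 𝔭` and `v_𝔭(c₀) = 1`, then `n v_𝔓(θ) = e` (the constant
term dominates: `v(c_k θ^k) ≥ e + k > e = v(c₀)` for `k ≥ 1`, so `v(θⁿ) = v(c₀) = e`).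
[cite: SerreLocalFields1979, Ch. I §6 Prop. 17–18] -/
theorem natDegree_mul_ord_root_eq (h𝔓 : 𝔓 ≠ ⊥) {θ : integralClosure R L} {n : ℕ} (hn : 0 < n)
    {c : ℕ → R} (hθ : θ ^ n + ∑ k ∈ Finset.range n, algebraMap R _ (c k) * θ ^ k = 0)
    (hc : ∀ k < n, c k ∈ 𝔓.under R) (hc₀ : c 0 ∉ (𝔓.under R) ^ 2) :
    (n : ℕ∞) * ord 𝔓 θ = (𝔓.under R).ramificationIdx' 𝔓 := by
  haveI : IsDedekindDomain (integralClosure R L) := integralClosure.isDedekindDomain R K L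
  set e := (𝔓.under R).ramificationIdx' 𝔓 with he
  set C : ℕ → integralClosure R L := fun k ↦ algebraMap R (integralClosure R L) (c k) with hC
  -- orders of the coefficients
  have hord₀ : ord 𝔓 (C 0) = e := by
    rw [hC]
    change ord 𝔓 (algebraMap R (integralClosure R L) (c 0)) = e
    rw [ord_algebraMap (K := K) 𝔓 h𝔓, ord_eq_one _ (hc 0 hn) hc₀, mul_one]
  have hle : ∀ k < n, (e : ℕ∞) ≤ ord 𝔓 (C k) := by
    intro k hk
    change (e : ℕ∞) ≤ ord 𝔓 (algebraMap R (integralClosure R L) (c k))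
    rw [ord_algebraMap (K := K) 𝔓 h𝔓]
    have h1 : (1 : ℕ∞) ≤ ord (𝔓.under R) (c k) := by
      rw [show (1 : ℕ∞) = ((1 : ℕ) : ℕ∞) from rfl, ← mem_pow_iff_le_ord, pow_one]
      exact hc k hk
    calc (e : ℕ∞) = e * 1 := (mul_one _).symm
      _ ≤ e * ord (𝔓.under R) (c k) := by gcongr
  -- `θ ∈ 𝔓`, `v(θ) = m ≥ 1`
  have hθP : θ ∈ 𝔓 := root_mem_of_forall_coeff_mem R 𝔓 hθ hc
  have hθ0 : θ ≠ 0 := by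
    rintro rfl
    apply hc₀
    have hsum : ∑ k ∈ Finset.range n, C k * (0 : integralClosure R L) ^ k = C 0 := by
      rw [Finset.sum_eq_single_of_mem 0 (Finset.mem_range.mpr hn)]
      · simp
      · intro k _ hk0
        rw [zero_pow hk0, mul_zero]
    have hC0 : C 0 = 0 := by
      have := hθ
      rw [zero_pow hn.ne', zero_add] at this
      rw [← hsum]; exact this
    have hc00 : c 0 = 0 := by
      haveI := faithfulSMul_integralClosure R (K := K) (L := L)
      exact (FaithfulSMul.algebraMap_injective R (integralClosure R L)) (by rw [map_zero]; exact hC0)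
    rw [hc00]
    exact zero_mem _
  obtain ⟨m, hm⟩ := exists_ord_eq_natCast 𝔓 h𝔓 hθ0
  have hm1 : 1 ≤ m := by
    have := (mem_pow_iff_le_ord 𝔓 (n := 1)).mp (by rwa [pow_one])
    rw [hm] at this
    exact_mod_cast this
  -- the tail `Σ_{1 ≤ k < n} c_k θ^k` lies in `𝔓^{e+1}`
  set tail := ∑ k ∈ Finset.range n \ {0}, C k * θ ^ k with htail
  have htail_mem : tail ∈ 𝔓 ^ (e + 1) := by
    refine Ideal.sum_mem _ fun k hk ↦ ?_
    rw [Finset.mem_sdiff, Finset.mem_range, Finset.mem_singleton] at hk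
    rw [mem_pow_iff_le_ord, ord_mul 𝔓 h𝔓, ord_pow 𝔓 h𝔓, hm]
    calc ((e + 1 : ℕ) : ℕ∞) ≤ (e : ℕ∞) + (k : ℕ∞) * (m : ℕ∞) := by
          have : 1 ≤ k * m := Nat.le_of_lt_succ (by nlinarith [hm1, Nat.pos_of_ne_zero hk.2])
          exact_mod_cast (by omega : e + 1 ≤ e + k * m)
      _ ≤ ord 𝔓 (C k) + (k : ℕ∞) * (m : ℕ∞) := by gcongr; exact hle k hk.1
  have hsplit : ∑ k ∈ Finset.range n, C k * θ ^ k = C 0 + tail := by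
    rw [htail, ← Finset.sum_sdiff (Finset.singleton_subset_iff.mpr (Finset.mem_range.mpr hn)),
      Finset.sum_singleton, pow_zero, mul_one, add_comm]
  -- `v(c₀ + tail) = e`
  have hordsum : ord 𝔓 (∑ k ∈ Finset.range n, C k * θ ^ k) = e := by
    rw [hsplit, add_comm]
    have hlt : ord 𝔓 (C 0) < ord 𝔓 tail := by
      rw [hord₀]
      exact lt_of_lt_of_le (by exact_mod_cast Nat.lt_succ_self e) ((mem_pow_iff_le_ord 𝔓).mp htail_mem)
    rw [ord_add_eq_of_lt 𝔓 hlt, hord₀]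
  -- `v(θⁿ) = v(-(c₀ + tail)) = e`
  have hrel : θ ^ n = -(∑ k ∈ Finset.range n, C k * θ ^ k) := by linear_combination hθ
  have key : ord 𝔓 (θ ^ n) = e := by rw [hrel, ord_neg, hordsum]
  rw [ord_pow 𝔓 h𝔓] at key
  exact key

include K in
/-- **Uniformizer from an Eisenstein equation.**  In the setting of `natDegree_mul_ord_root_eq`,
if `e(𝔓 ∣ 𝔭) ≤ n` (e.g. `n = [L : K]`), then `v_𝔓(θ) = 1` and `e(𝔓 ∣ 𝔭) = n`: `𝔓` is totally
ramified of index `n` and `θ` is a uniformizer. [cite: SerreLocalFields1979, Ch. I §6 Prop. 17–18] -/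
theorem ord_root_eq_one_of_ramificationIdx_le (h𝔓 : 𝔓 ≠ ⊥) {θ : integralClosure R L} {n : ℕ}
    (hn : 0 < n) {c : ℕ → R}
    (hθ : θ ^ n + ∑ k ∈ Finset.range n, algebraMap R _ (c k) * θ ^ k = 0)
    (hc : ∀ k < n, c k ∈ 𝔓.under R) (hc₀ : c 0 ∉ (𝔓.under R) ^ 2)
    (hen : (𝔓.under R).ramificationIdx' 𝔓 ≤ n) :
    ord 𝔓 θ = 1 ∧ (𝔓.under R).ramificationIdx' 𝔓 = n := by
  haveI : IsDedekindDomain (integralClosure R L) := integralClosure.isDedekindDomain R K L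
  have key := natDegree_mul_ord_root_eq R (K := K) 𝔓 h𝔓 hn hθ hc hc₀
  have hθP : θ ∈ 𝔓 := root_mem_of_forall_coeff_mem R 𝔓 hθ hc
  have hθ0 : θ ≠ 0 := by
    rintro rfl
    rw [ord_zero, ENat.mul_top (by exact_mod_cast hn.ne')] at key
    exact ENat.top_ne_coe _ key
  obtain ⟨m, hm⟩ := exists_ord_eq_natCast 𝔓 h𝔓 hθ0
  have hm1 : 1 ≤ m := by
    have := (mem_pow_iff_le_ord 𝔓 (n := 1)).mp (by rwa [pow_one])
    rw [hm] at this
    exact_mod_cast this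
  rw [hm] at key
  have key' : n * m = (𝔓.under R).ramificationIdx' 𝔓 := by exact_mod_cast key
  have hm' : m = 1 := by nlinarith
  subst hm'
  refine ⟨hm, ?_⟩
  omega

end Literature.NumberTheory.GaloisRepresentations

end
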